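import Summits.CriticalPhenomena.PercolationContinuityZ3.Theses.PercLowPointHalfSpace
import Literature.Probability.Percolation.CriticalContinuityProofs
import Literature.Probability.Percolation.SharpnessDCTProofs
import Literature.Probability.Percolation.LatticeSymmetry

/-!
# A rigorous lower bound on the boundary one-arm at `p_c(ℤ³)` (negative-side support for crux
# `BoundaryTwoArmDecay`, stmt-CriticalPhenomena-0911, route `PercLowPointHalfSpace`; refuter cdisprove seat)

`halfSpaceArm_ge`: for bond percolation on `ℤ³` at `p_c`, with `H = {x₀ ≥ 0}`,
`P_{p_c}(C_H(0) reaches sup-distance ≥ n) ≥ 1 / (36 (2n+1)²)` for every `n` — the event is verbatim the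
set of item C (`QuantitativeBGN`) and the first conjunct of the crux event of item A.

Proof: `φ_{p_c}(Λ_n) ≥ 1` (`one_le_phi_criticalProb`: continuity of the cylinder polynomial `q ↦ φ_q(S)`
and `p̃_c = p_c`, Duminil-Copin–Tassion 2016 Thm 1.1, both in tree, plus `p_c(ℤ³) < 1`); each of the
`≤ 36(2n+1)²` terms `P(0 ↔ x in Λ_n)` of `φ` is at most `P(armBox n)` by a signed permutation taking `x` to
the bottom face and the translation `x ↦ 0` (`real_openConnIn_box_le_armBox`).

Consequence `quantitativeBGN_exponent_le_two`: an exponent `a` with `P(arm_H(0,r)) ≤ C r^{-a}` (`r ≥ 1`)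
has `a ≤ 2` — the tightness side of item C (numerically `a = x_s ≈ 0.975`, Deng–Blöte 2005).
No route statement is asserted positively.

References: Duminil-Copin–Tassion, CMP 343 (2016) Thm 1.1 [DuminilCopinTassionEM2016]; Grimmett,
Percolation (1999) §1.4 [Grimmett1999]; Deng–Blöte, Phys. Rev. E 71 (2005) 016117 (numerics).
-/
namespace Summit.CriticalPhenomena.PercolationContinuityZ3.Theorems.BoundaryTwoArmDecay.Negative

open MeasureTheory ProbabilityTheory Filter Topology
open Literature.Probability.Percolation Literature.Probability.LatticeModels
open Literature.Probability.Percolation.DCT16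
open Summit.CriticalPhenomena.PercolationContinuityZ3.Theses.PercLowPointHalfSpace

noncomputable section


/-- The half-space `H = {x₀ ≥ 0}`. -/
abbrev H : Set (Site 3) := {x : Site 3 | 0 ≤ x 0}

/-- The floor neighbour `e = (0,1,0)` of the origin. -/
abbrev e : Site 3 := Pi.single 1 1

/-- The critical bond measure on `ℤ³`. -/
abbrev μ : Measure (BondConfig (Site 3)) := bondPercolation (zdGraph 3) (criticalProbI 3)




/-! ## The Hammersley / Duminil-Copin–Tassion input at `p_c(ℤ³)` -/

/-- `q ↦ φ_q(S)` (parameter clamped to `[0,1]`) is continuous: a finite sum of cylinder polynomials. -/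
theorem continuous_phi (S : Finset (Site 3)) :
    Continuous (fun q : ℝ => DCT16.phi (Set.projIcc (0 : ℝ) 1 zero_le_one q) S) := by
  classical
  simp only [DCT16.phi_def]
  refine (continuous_subtype_val.comp continuous_projIcc).mul ?_
  refine continuous_finsetSum _ fun x _ => continuous_finsetSum _ fun y _ => ?_
  have h : (fun q : ℝ => (bondPercolation (zdGraph 3) (Set.projIcc 0 1 zero_le_one q)).real
      (openConnIn (↑S : Set (Site 3)) 0 x)) = fun q => Russo.cylPoly (zdGraph 3).edgeSet S.sym2
        (openConnIn (↑S : Set (Site 3)) 0 x) (Set.projIcc 0 1 zero_le_one q) := by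
    funext q
    rw [bondPercolation]
    exact Russo.measureReal_eq_cylPoly
      (determinedBy_openConnIn (↑S : Set (Site 3)) 0 x (K := ↑S.sym2) (by rw [Finset.coe_sym2])) _ _
  rw [h]
  exact (continuous_iff_continuousAt.2 fun q => (Russo.hasDerivAt_cylPoly _ _ _ q).continuousAt).comp
    (continuous_subtype_val.comp continuous_projIcc)

/-- **`φ_{p_c}(S) ≥ 1` for every finite `S ∋ 0`** (bond percolation on `ℤ³`): otherwise, by continuity,
`φ_q(S) < 1` for some `q ∈ (p_c, 1)`, so `q ≤ p̃_c = p_c` (Duminil-Copin–Tassion 2016, Thm 1.1, in tree),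
absurd. Uses `p_c(ℤ³) < 1` (Grimmett 1999 §1.4, in tree). -/
theorem one_le_phi_criticalProb {S : Finset (Site 3)} (h0S : (0 : Site 3) ∈ S) :
    1 ≤ DCT16.phi (criticalProbI 3) S := by
  by_contra hlt
  rw [not_le] at hlt
  set pc : ℝ := criticalProb (zdGraph 3) (0 : Site 3) with hpc
  have hpc1 : pc < 1 := (Grimmett1999_criticalProb_pos_lt_one_holds 3 (by norm_num)).2
  have hpc0 : 0 ≤ pc := (criticalProb_mem_Icc (zdGraph 3) (0 : Site 3)).1
  have hproj : Set.projIcc (0 : ℝ) 1 zero_le_one pc = criticalProbI 3 := by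
    rw [Set.projIcc_of_mem _ ⟨hpc0, hpc1.le⟩]; rfl
  have hcont : ContinuousAt (fun q : ℝ => DCT16.phi (Set.projIcc (0 : ℝ) 1 zero_le_one q) S) pc :=
    (continuous_phi S).continuousAt
  have hlt' : (fun q : ℝ => DCT16.phi (Set.projIcc (0 : ℝ) 1 zero_le_one q) S) pc < 1 := by
    simp only [hproj]; exact hlt
  have hev : ∀ᶠ q in 𝓝 pc, DCT16.phi (Set.projIcc (0 : ℝ) 1 zero_le_one q) S < 1 :=
    hcont.preimage_mem_nhds (Iio_mem_nhds hlt')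
  obtain ⟨δ, hδ, hball⟩ := Metric.eventually_nhds_iff.1 hev
  set q : ℝ := pc + min (δ / 2) ((1 - pc) / 2) with hq
  have hmin_pos : 0 < min (δ / 2) ((1 - pc) / 2) := lt_min (by linarith) (by linarith)
  have hq_gt : pc < q := by rw [hq]; linarith
  have hq_lt1 : q < 1 := by
    have := min_le_right (δ / 2) ((1 - pc) / 2); rw [hq]; linarith
  have hq_dist : dist q pc < δ := by
    have := min_le_left (δ / 2) ((1 - pc) / 2)
    rw [Real.dist_eq, abs_of_pos (by linarith)]; rw [hq]; linarith
  have hq01 : q ∈ unitInterval := ⟨by linarith, hq_lt1.le⟩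
  have hφq := hball hq_dist
  rw [Set.projIcc_of_mem _ hq01] at hφq
  have h1 : q ≤ DCT16.tildeCriticalProb 3 :=
    le_csSup (DCT16.bddAbove_tildeSet 3) ⟨hq01, S, h0S, hφq⟩
  have h2 : DCT16.tildeCriticalProb 3 ≤ pc := tildeCriticalProb_le_criticalProb 3
  linarith

/-! ## Geometry: the finite-volume boundary arm event -/

/-- Sites at sup-distance `≥ n` from the origin. -/
def far (n : ℕ) : Set (Site 3) := {y | ∃ i : Fin 3, (n : ℤ) ≤ |y i|}

/-- The half-box `{0 ≤ w₀} ∩ Λ_{2n}`. -/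
def halfBox (n : ℕ) : Finset (Site 3) := (box 3 (2 * n)).filter fun w => 0 ≤ w 0

/-- The finite-volume boundary one-arm event: `0` is joined inside the half-box `H ∩ Λ_{2n}` to a site at
sup-distance `≥ n`. -/
def armBox (n : ℕ) : Set (BondConfig (Site 3)) := openCrossing (↑(halfBox n)) {0} (far n)

/-- The half-box lies in the half-space `H`. -/
theorem halfBox_subset_H (n : ℕ) : (↑(halfBox n) : Set (Site 3)) ⊆ H := by
  intro w hw
  rw [Finset.mem_coe, halfBox, Finset.mem_filter] at hw
  exact hw.2

/-- `{x ↔ y in S}` is monotone in `S` (local copy of `RSW.openConnIn_mono`). -/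
theorem openConnIn_mono' {V : Type*} {S S' : Set V} (h : S ⊆ S') (x y : V) :
    (openConnIn S x y : Set (BondConfig V)) ⊆ openConnIn S' x y := by
  rintro ω ⟨hx, hy, hr⟩
  exact ⟨h hx, h hy, hr.map (SimpleGraph.induceHomOfLE (G := openGraph ω) h).toHom⟩

/-- `{x ↔ y in S}` is symmetric (local copy). -/
theorem openConnIn_comm' {V : Type*} (S : Set V) (x y : V) :
    (openConnIn S x y : Set (BondConfig V)) = openConnIn S y x := by
  ext ω
  constructor <;> rintro ⟨hx, hy, h⟩ <;> exact ⟨hy, hx, h.symm⟩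

/-- A crossing between singletons is a restricted connection. -/
theorem openCrossing_singleton' {V : Type*} (S : Set V) (x y : V) :
    openCrossing S {x} {y} = openConnIn S x y := by
  ext ω; simp [openCrossing]

/-- The finite-volume arm lies inside the crux's (infinite half-space) one-arm event. -/
theorem armBox_subset_halfSpaceArm (n : ℕ) :
    armBox n ⊆ {ω | ∃ y : Site 3, (∃ i : Fin 3, (n : ℤ) ≤ |y i|) ∧ ω ∈ openConnIn H 0 y} := by
  rintro ω ⟨a, ha, b, hb, hω⟩
  rw [Set.mem_singleton_iff] at ha
  subst ha
  exact ⟨b, hb, openConnIn_mono' (halfBox_subset_H n) _ _ hω⟩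

/-- `armBox n` is measurable (a countable union of local events). -/
theorem measurableSet_armBox (n : ℕ) : MeasurableSet (armBox n) := by
  have h : armBox n = ⋃ y ∈ far n, openConnIn (↑(halfBox n) : Set (Site 3)) 0 y := by
    ext ω; simp [armBox, openCrossing]
  rw [h]
  exact MeasurableSet.biUnion (Set.to_countable _) fun y _ => measurableSet_openConnIn (halfBox n) 0 y

/-- **Symmetry + translation step.** For a site `x` of the inner boundary of `Λ_n`,
`P(0 ↔ x in Λ_n) ≤ P(armBox n)`: rotate `x` onto the bottom face (`signedPerm`, preserves `Λ_n`, `0` and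
`P_{p_c}`), then translate `x ↦ 0`; the box goes into the half-box `H ∩ Λ_{2n}` and `0` goes to a site at
sup-distance `n`. -/
theorem real_openConnIn_box_le_armBox {n : ℕ} {x : Site 3}
    (hx : x ∈ innerBoundary (zdGraph 3) (box 3 n)) :
    μ.real (openConnIn (↑(box 3 n) : Set (Site 3)) 0 x) ≤ μ.real (armBox n) := by
  obtain ⟨i, hi⟩ := exists_eq_of_mem_innerBoundary_box hx
  have hxbox : x ∈ box 3 n := (mem_innerBoundary_iff.1 hx).1
  obtain ⟨s, hs⟩ : ∃ s : ℤˣ, (s : ℤ) * x i = -n := by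
    rcases hi with h | h
    · exact ⟨-1, by rw [h]; simp⟩
    · exact ⟨1, by rw [h]; simp⟩
  set ψ : zdGraph 3 ≃g zdGraph 3 := zdSignedPermIso (Equiv.swap i 0) (fun _ => s) with hψ
  have hψ0 : ψ 0 = 0 := Site.signedPerm_zero _ _
  have hψx0 : (ψ x) 0 = -n := by
    show (Site.signedPerm (Equiv.swap i 0) (fun _ => s) x) 0 = -n
    rw [Site.signedPerm_apply, Equiv.symm_swap, Equiv.swap_apply_right]; exact hs
  have hψbox : ψ '' (↑(box 3 n) : Set (Site 3)) = ↑(box 3 n) := signedPerm_image_box _ _ n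
  have hψxbox : ψ x ∈ box 3 n := (signedPerm_mem_box_iff _ _).2 hxbox
  -- step 1: symmetry
  have h1 : μ.real (openConnIn (↑(box 3 n) : Set (Site 3)) 0 x) =
      μ.real (openConnIn (↑(box 3 n) : Set (Site 3)) 0 (ψ x)) := by
    have := bondPercolation_real_image ψ (criticalProbI 3) (↑(box 3 n) : Set (Site 3)) {0} {x}
    rw [Set.image_singleton, Set.image_singleton, hψbox, hψ0, openCrossing_singleton',
      openCrossing_singleton'] at this
    exact this.symm
  -- step 2: inclusion into the translated arm event
  set x' : Site 3 := ψ x with hx'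
  have hx'box : ∀ j, -(n : ℤ) ≤ x' j ∧ x' j ≤ n := mem_box.1 hψxbox
  have h2 : (openConnIn (↑(box 3 n) : Set (Site 3)) 0 x' : Set (BondConfig (Site 3))) ⊆
      openCrossing ((· + x') '' (↑(halfBox n) : Set (Site 3))) ((· + x') '' {0}) ((· + x') '' far n) := by
    intro ω hω
    refine ⟨x', ⟨0, rfl, zero_add x'⟩, 0, ⟨-x', ⟨0, ?_⟩, neg_add_cancel x'⟩, ?_⟩
    · simp [hψx0]
    · rw [openConnIn_comm'] at hω
      refine openConnIn_mono' ?_ _ _ hω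
      intro w hw
      refine ⟨w - x', ?_, sub_add_cancel w x'⟩
      rw [Finset.mem_coe] at hw ⊢
      rw [halfBox, Finset.mem_filter, mem_box]
      have hwb := mem_box.1 hw
      refine ⟨fun j => ?_, ?_⟩
      · have := hwb j; have := hx'box j
        simp only [Pi.sub_apply, Nat.cast_mul, Nat.cast_ofNat]
        omega
      · simp only [Pi.sub_apply, hψx0]
        have := hwb 0
        omega
  have h3 := real_openCrossing_shift (criticalProbI 3) x' (↑(halfBox n) : Set (Site 3)) {0} (far n)
  calc μ.real (openConnIn (↑(box 3 n) : Set (Site 3)) 0 x)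
      = μ.real (openConnIn (↑(box 3 n) : Set (Site 3)) 0 x') := h1
    _ ≤ μ.real (openCrossing ((· + x') '' (↑(halfBox n) : Set (Site 3))) ((· + x') '' {0})
          ((· + x') '' far n)) := measureReal_mono h2
    _ = μ.real (armBox n) := h3

/-- Counting: `Σ_{x ∈ Λ_n} #{y ∼ x : y ∉ Λ_n} ≤ 6 |∂ⁱⁿΛ_n| ≤ 36 (2n+1)²`. -/
theorem sum_card_outer_le (n : ℕ) :
    ∑ x ∈ box 3 n, (((zdGraph 3).neighborFinset x).filter (fun y => y ∉ box 3 n)).card ≤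
      36 * (2 * n + 1) ^ 2 := by
  classical
  have hterm : ∀ x ∈ box 3 n, (((zdGraph 3).neighborFinset x).filter (fun y => y ∉ box 3 n)).card ≤
      if x ∈ innerBoundary (zdGraph 3) (box 3 n) then 6 else 0 := by
    intro x hx
    split_ifs with hb
    · calc (((zdGraph 3).neighborFinset x).filter (fun y => y ∉ box 3 n)).card
          ≤ ((zdGraph 3).neighborFinset x).card := Finset.card_filter_le _ _
        _ = 2 * 3 := card_neighborFinset_zdGraph_holds x
        _ = 6 := by norm_num
    · rw [Nat.le_zero, Finset.card_eq_zero, Finset.filter_eq_empty_iff]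
      intro y hy hyn
      exact hb (mem_innerBoundary_iff.2 ⟨hx, y, hyn, (SimpleGraph.mem_neighborFinset _ _ _).1 hy⟩)
  calc ∑ x ∈ box 3 n, (((zdGraph 3).neighborFinset x).filter (fun y => y ∉ box 3 n)).card
      ≤ ∑ x ∈ box 3 n, (if x ∈ innerBoundary (zdGraph 3) (box 3 n) then 6 else 0) :=
        Finset.sum_le_sum hterm
    _ = ∑ x ∈ (box 3 n).filter (fun x => x ∈ innerBoundary (zdGraph 3) (box 3 n)), 6 := by
        rw [Finset.sum_filter]
    _ = 6 * ((box 3 n).filter (fun x => x ∈ innerBoundary (zdGraph 3) (box 3 n))).card := by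
        rw [Finset.sum_const, smul_eq_mul, mul_comm]
    _ ≤ 6 * (innerBoundary (zdGraph 3) (box 3 n)).card := by
        gcongr
        exact fun x hx => (Finset.mem_filter.1 hx).2
    _ ≤ 6 * (2 * 3 * (2 * n + 1) ^ (3 - 1)) := by
        gcongr
        exact card_innerBoundary_box_le n
    _ = 36 * (2 * n + 1) ^ 2 := by norm_num; ring

/-- **A rigorous polynomial LOWER bound on the boundary one-arm at `p_c(ℤ³)`**:
`P_{p_c}(armBox n) ≥ 1 / (36 (2n+1)²)`. Proof: `1 ≤ φ_{p_c}(Λ_n) = p_c Σ_{x} Σ_{y ∼ x, y ∉ Λ_n} P(0 ↔ x in Λ_n)`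
(Duminil-Copin–Tassion), every term is `≤ P(armBox n)` by symmetry + translation
(`real_openConnIn_box_le_armBox`), and there are at most `36 (2n+1)²` terms. -/
theorem armBox_ge (n : ℕ) : 1 / (36 * (2 * (n : ℝ) + 1) ^ 2) ≤ μ.real (armBox n) := by
  classical
  have hφ := one_le_phi_criticalProb (S := box 3 n) (zero_mem_box 3 n)
  rw [DCT16.phi_def] at hφ
  set P : ℝ := μ.real (armBox n) with hP
  set T : ℝ := ∑ x ∈ box 3 n, ∑ y ∈ (zdGraph 3).neighborFinset x with y ∉ box 3 n,
    (bondPercolation (zdGraph 3) (criticalProbI 3)).real (openConnIn (↑(box 3 n) : Set (Site 3)) 0 x)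
    with hT
  have hpc1 : ((criticalProbI 3 : unitInterval) : ℝ) ≤ 1 := (criticalProbI 3).2.2
  have hT0 : 0 ≤ T :=
    Finset.sum_nonneg fun _ _ => Finset.sum_nonneg fun _ _ => measureReal_nonneg
  have hsum_le : T ≤ ∑ x ∈ box 3 n, ∑ y ∈ (zdGraph 3).neighborFinset x with y ∉ box 3 n, P := by
    refine Finset.sum_le_sum fun x hx => Finset.sum_le_sum fun y hy => ?_
    rw [Finset.mem_filter] at hy
    exact real_openConnIn_box_le_armBox
      (mem_innerBoundary_iff.2 ⟨hx, y, hy.2, (SimpleGraph.mem_neighborFinset _ _ _).1 hy.1⟩)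
  have hcount : (∑ x ∈ box 3 n, ∑ y ∈ (zdGraph 3).neighborFinset x with y ∉ box 3 n, P) ≤
      36 * (2 * (n : ℝ) + 1) ^ 2 * P := by
    simp only [Finset.sum_const, nsmul_eq_mul]
    rw [← Finset.sum_mul]
    refine mul_le_mul_of_nonneg_right ?_ measureReal_nonneg
    have := sum_card_outer_le n
    exact_mod_cast this
  have key : (1 : ℝ) ≤ 36 * (2 * (n : ℝ) + 1) ^ 2 * P :=
    calc (1 : ℝ) ≤ (criticalProbI 3 : ℝ) * T := hφ
      _ ≤ 1 * T := mul_le_mul_of_nonneg_right hpc1 hT0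
      _ = T := one_mul T
      _ ≤ _ := hsum_le
      _ ≤ _ := hcount
  rw [div_le_iff₀ (by positivity)]
  linarith

/-- The same bound for the crux's infinite-volume one-arm event (the set of `QuantitativeBGN`, item C):
`P_{p_c}(C_H(0) reaches sup-distance ≥ n) ≥ 1/(36(2n+1)²)`. -/
theorem halfSpaceArm_ge (n : ℕ) :
    1 / (36 * (2 * (n : ℝ) + 1) ^ 2) ≤
      μ.real {ω | ∃ y : Site 3, (∃ i : Fin 3, (n : ℤ) ≤ |y i|) ∧ ω ∈ openConnIn H 0 y} :=
  (armBox_ge n).trans (measureReal_mono (armBox_subset_halfSpaceArm n))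

/-- Large powers: for `b > 0` and any `M` there is `r ≥ 1` with `M < r^b`. -/
theorem exists_nat_rpow_gt {b : ℝ} (hb : 0 < b) (M : ℝ) : ∃ r : ℕ, 1 ≤ r ∧ M < (r : ℝ) ^ b := by
  have h1 : ∀ᶠ r : ℕ in atTop, M < (r : ℝ) ^ b :=
    ((tendsto_rpow_atTop hb).comp tendsto_natCast_atTop_atTop).eventually_gt_atTop M
  obtain ⟨r, hr1, hr2⟩ := ((eventually_ge_atTop 1).and h1).exists
  exact ⟨r, hr1, hr2⟩

/-- **TIGHTNESS for item C (`QuantitativeBGN`)**: any admissible exponent satisfies `a ≤ 2`.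
(Numerically `a = x_s ≈ 0.975`; the rigorous window for the boundary one-arm exponent at `p_c(ℤ³)` is
thus `(0, 2]` — the lower end `a > 0` being exactly crux C.) -/
theorem quantitativeBGN_exponent_le_two {a C : ℝ}
    (h : ∀ r : ℕ, 1 ≤ r → μ.real {ω | ∃ y : Site 3, (∃ i : Fin 3, (r : ℤ) ≤ |y i|) ∧
      ω ∈ openConnIn H 0 y} ≤ C * (r : ℝ) ^ (-a)) : a ≤ 2 := by
  by_contra ha
  rw [not_le] at ha
  -- for r ≥ 1: 1/(36 (2r+1)^2) ≤ C r^{-a}, and (2r+1)^2 ≤ 9 r^2, so r^{a-2} ≤ 324 C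
  have hb : 0 < a - 2 := by linarith
  obtain ⟨r, hr1, hr⟩ := exists_nat_rpow_gt hb (324 * |C| + 1)
  have hr0 : (0 : ℝ) < r := by exact_mod_cast hr1
  have hlow := (halfSpaceArm_ge r).trans (h r hr1)
  -- C r^{-a} ≤ |C| r^{-a}
  have hrpow_pos : 0 < (r : ℝ) ^ (-a) := Real.rpow_pos_of_pos hr0 _
  have hC : C * (r : ℝ) ^ (-a) ≤ |C| * (r : ℝ) ^ (-a) :=
    mul_le_mul_of_nonneg_right (le_abs_self C) hrpow_pos.le
  have h9 : (2 * (r : ℝ) + 1) ^ 2 ≤ 9 * (r : ℝ) ^ (2 : ℝ) := by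
    rw [Real.rpow_two]; have : (1 : ℝ) ≤ r := by exact_mod_cast hr1
    nlinarith
  -- 1 ≤ 36 (2r+1)^2 |C| r^{-a} ≤ 324 |C| r^2 r^{-a} = 324 |C| r^{-(a-2)}
  have h36 : (1 : ℝ) ≤ 36 * (2 * (r : ℝ) + 1) ^ 2 * (|C| * (r : ℝ) ^ (-a)) := by
    have := hlow.trans hC
    rwa [div_le_iff₀ (by positivity), mul_comm] at this
  have hsplit : (r : ℝ) ^ (2 : ℝ) * (r : ℝ) ^ (-a) = ((r : ℝ) ^ (a - 2))⁻¹ := by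
    rw [← Real.rpow_add hr0, ← Real.rpow_neg hr0.le]; congr 1; ring
  have hpow_pos : 0 < (r : ℝ) ^ (a - 2) := Real.rpow_pos_of_pos hr0 _
  have : (1 : ℝ) ≤ 324 * |C| * ((r : ℝ) ^ (a - 2))⁻¹ := by
    calc (1 : ℝ) ≤ 36 * (2 * (r : ℝ) + 1) ^ 2 * (|C| * (r : ℝ) ^ (-a)) := h36
      _ ≤ 36 * (9 * (r : ℝ) ^ (2 : ℝ)) * (|C| * (r : ℝ) ^ (-a)) := by gcongr
      _ = 324 * |C| * ((r : ℝ) ^ (2 : ℝ) * (r : ℝ) ^ (-a)) := by ring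
      _ = 324 * |C| * ((r : ℝ) ^ (a - 2))⁻¹ := by rw [hsplit]
  rw [← div_eq_mul_inv, le_div_iff₀ hpow_pos, one_mul] at this
  linarith [abs_nonneg C]

end

end Summit.CriticalPhenomena.PercolationContinuityZ3.Theorems.BoundaryTwoArmDecay.Negative
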